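import Summits.CriticalPhenomena.PercolationContinuityZ3.Theorems.PercNearOneGluingNoHeavyLowerTailTypedReductions
import Summits.CriticalPhenomena.PercolationContinuityZ3.Theorems.PercNearOneGluingAdditiveGluingGenOfSurplusTransfer
import HarnessLib

/-!
# `NoHeavyLowerTail` (stmt-CriticalPhenomena-4575) follows from the surplus-transfer inequality (S5) for all relay sets

Typed reduction, prover `prim-gen-induct` (gen 10), `--supports stmt-CriticalPhenomena-4575`.  No definitions, no named facts,
no sorries; standard axioms.

The cell's (S5)_r programme (seat memo prim-hp-8/PROOF-S5-ALL-R.md: a claimed proof of (S5)_r for every r from the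
conditioned slack hierarchy, refereed ×2, Lean pieces `…CSH*` in progress) targets the hypothesis `hS5` of
`AGloc.gen_firstRank_of_surplusTransfer` / `AGloc.additiveGluing_of_surplusTransfer` (crux stmt-4576 `AdditiveGluing`).
This file records that the SAME hypothesis closes THIS crux too, by the tree's chain
(S5) ⟹ `AdditiveGluing` (`AGloc.additiveGluing_of_surplusTransfer`) ⟹ `NearOneGluing` (`additiveGluingSuffices_proof`)
⟹ `stub_manyFingersLargePocket` (`manyFingersLargePocket_of_nearOneGluing`) ⟹ `NoHeavyLowerTail`
(`noHeavyLowerTail_of_manyFingersLargePocket`).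

* `noHeavyLowerTail_of_surplusTransfer` — `hS5 → NoHeavyLowerTail`.
-/

noncomputable section

namespace Summit.CriticalPhenomena.PercolationContinuityZ3.Theorems

open MeasureTheory Set Literature.Probability.LatticeModels Literature.Probability.Percolation
open Summit.CriticalPhenomena.PercolationContinuityZ3.Theses.PercNearOneGluing
open scoped Classical

/-- **`NoHeavyLowerTail` from the surplus transfer (S5) for all relay sets** — verbatim the hypothesis `hS5` of
`AGloc.additiveGluing_of_surplusTransfer` (observers `o, v`, `v ∉ T`, `F` monotone nonnegative on vertex sets, an injective rank
`r` on `T` compatible with the means `m_a = ∫ F(C(a))`; `Sur_u(T) = ∫_{u↔T} F(C(u)) − Σ_a μ(u ↔ a, u ↮ {a' : r a' < r a})·m_a`;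
(S5): `μ(v ↮ T, o ↔ v)·Sur_v(T) ≤ μ(v ↮ T)·Sur_o(T)`).  [cite: KozmaNitzan2024, Conj. 1 (p. 3), Conj. 4 (p. 32)] -/
theorem noHeavyLowerTail_of_surplusTransfer
    (hS5 : ∀ (n : ℕ) (w : Sym2 (Fin n) → unitInterval) (T : Finset (Fin n)) (o v : Fin n) (F : Set (Fin n) → ℝ) (r : Fin n → ℕ),
      v ∉ T → (∀ S S' : Set (Fin n), S ⊆ S' → F S ≤ F S') → (∀ S, 0 ≤ F S) → Set.InjOn r ↑T →
      (∀ a ∈ T, ∀ a' ∈ T, r a < r a' →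
        ∫ ω, F (openCluster ω a) ∂(prodBernoulli w) ≤ ∫ ω, F (openCluster ω a') ∂(prodBernoulli w)) →
      (prodBernoulli w).real ({ω : BondConfig (Fin n) | ∀ a ∈ T, ¬ (openGraph ω).Reachable v a} ∩ openConn o v) *
          (∫ ω in (⋃ a ∈ T, openConn v a), F (openCluster ω v) ∂(prodBernoulli w) -
            ∑ a ∈ T, (prodBernoulli w).real
                (openConn v a ∩ ⋂ a' ∈ T.filter (fun a' => r a' < r a), (openConn v a')ᶜ : Set (BondConfig (Fin n))) *
              ∫ ω, F (openCluster ω a) ∂(prodBernoulli w)) ≤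
        (prodBernoulli w).real {ω : BondConfig (Fin n) | ∀ a ∈ T, ¬ (openGraph ω).Reachable v a} *
          (∫ ω in (⋃ a ∈ T, openConn o a), F (openCluster ω o) ∂(prodBernoulli w) -
            ∑ a ∈ T, (prodBernoulli w).real
                (openConn o a ∩ ⋂ a' ∈ T.filter (fun a' => r a' < r a), (openConn o a')ᶜ : Set (BondConfig (Fin n))) *
              ∫ ω, F (openCluster ω a) ∂(prodBernoulli w))) :
    NoHeavyLowerTail :=
  noHeavyLowerTail_of_manyFingersLargePocket
    (manyFingersLargePocket_of_nearOneGluing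
      (additiveGluingSuffices_proof (AGloc.additiveGluing_of_surplusTransfer hS5)))

end Summit.CriticalPhenomena.PercolationContinuityZ3.Theorems

end
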